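import Summits.AnomalousDissipation.AnomalousDissipation.Theses.TwoAndHalfD
import Literature.Analysis.FluidPDE.TwoHalfNavierStokes
import Literature.Analysis.FluidPDE.TorusClassicalLerayHopfProofs
import Literature.Analysis.FunctionSpaces.TorusScalarTrigPoly
import Literature.Analysis.FunctionSpaces.TorusSpaceTime

/-!
# Negative knowledge for the crux `TwohalfdNeg` (stmt-AnomalousDissipation-0211), I: the laminar vertical-shear
# Leray–Hopf family

Certified copy of §1–§3 of the cdisprove work file `Cruxes/TwohalfdNeg/Disproof.lean` (route `TwoAndHalfD` #5 =
route `Neg` #3).  The steady vertical shear `shear n a = (0, 0, a cos(2π(n+1)x₀))` on `T³` — `x₃`-invariant,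
smooth, solenoidal, mean zero — is a classical, hence global Leray–Hopf, solution of NS_ν with zero pressure and
the steady force `shear n (4π²(n+1)²νa)` (packaging theorem `Torus.isClassicalNSSolutionOn_twoHalf` with vanishing
planar part, then `Torus.IsClassicalNSSolutionOn.isGlobalLerayHopf`), with HONEST long-time means
`meanEnergy = a²/2` and `meanDissipation = 2π²(n+1)²νa²` (`meanEnergy_shear`, `meanDissipation_shear`).  These are
the witnesses of the load-bearing analysis in `Negative/LoadBearing.lean` (energy ceiling, `ν_j → 0` and the
fixedness of the force are each necessary hypotheses of the crux).  Supports stmt-AnomalousDissipation-0211.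
-/

noncomputable section

namespace Summit.AnomalousDissipation.AnomalousDissipation.Theorems.TwohalfdNeg.Negative

open MeasureTheory Set Filter Topology UnitAddTorus
open scoped ENNReal NNReal InnerProductSpace ComplexConjugate
open Literature.Analysis.FunctionSpaces Literature.Analysis.FunctionSpaces.Torus
open Literature.Analysis.FluidPDE Literature.Analysis.FluidPDE.Torus

/-! ## 1. The planar cosine profile `a cos(2π(n+1)y₀)` -/

section Profile

/-- The planar frequency `(n+1) e₀`. [folklore] -/
def modeFreq (n : ℕ) : (Fin 2 → ℤ) := Pi.single 0 ((n : ℤ) + 1)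

/-- First coordinate of `(n+1)e₀`. [folklore] -/
@[simp] theorem modeFreq_apply_zero (n : ℕ) : modeFreq n 0 = (n : ℤ) + 1 := by simp [modeFreq]

/-- Second coordinate of `(n+1)e₀`. [folklore] -/
@[simp] theorem modeFreq_apply_one (n : ℕ) : modeFreq n 1 = 0 := by simp [modeFreq]

/-- `(n+1)e₀ ≠ 0`. [folklore] -/
theorem modeFreq_ne_zero (n : ℕ) : modeFreq n ≠ 0 := fun h => by
  have := congrFun h 0
  simp at this
  omega

/-- `(n+1)e₀ ≠ -(n+1)e₀`. [folklore] -/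
theorem modeFreq_ne_neg (n : ℕ) : modeFreq n ≠ -modeFreq n := fun h => by
  have := congrFun h 0
  simp at this
  omega

/-- `|(n+1)e₀|² = (n+1)²`. [folklore] -/
theorem freqNormSq_modeFreq (n : ℕ) : freqNormSq (modeFreq n) = ((n : ℝ) + 1) ^ 2 := by
  simp [freqNormSq, Fin.sum_univ_two]

/-- The symmetric frequency pair `{(n+1)e₀, -(n+1)e₀}`. [folklore] -/
def modeSet (n : ℕ) : Finset (Fin 2 → ℤ) := {modeFreq n, -modeFreq n}

/-- The frequency pair is symmetric. [folklore] -/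
theorem neg_mem_modeSet (n : ℕ) : ∀ k ∈ modeSet n, -k ∈ modeSet n := by
  intro k hk
  simp only [modeSet, Finset.mem_insert, Finset.mem_singleton] at hk ⊢
  rcases hk with rfl | rfl <;> simp

/-- The frequency pair avoids the zero mode. [folklore] -/
theorem ne_zero_of_mem_modeSet {n : ℕ} {k : (Fin 2 → ℤ)} (hk : k ∈ modeSet n) : k ≠ 0 := by
  simp only [modeSet, Finset.mem_insert, Finset.mem_singleton] at hk
  rcases hk with rfl | rfl
  · exact modeFreq_ne_zero n
  · exact neg_ne_zero.2 (modeFreq_ne_zero n)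

/-- Both frequencies of the pair have `|k|² = (n+1)²`. [folklore] -/
theorem freqNormSq_of_mem_modeSet {n : ℕ} {k : (Fin 2 → ℤ)} (hk : k ∈ modeSet n) :
    freqNormSq k = ((n : ℝ) + 1) ^ 2 := by
  simp only [modeSet, Finset.mem_insert, Finset.mem_singleton] at hk
  rcases hk with rfl | rfl
  · exact freqNormSq_modeFreq n
  · rw [freqNormSq_neg, freqNormSq_modeFreq]

/-- The pair has two elements. [folklore] -/
theorem card_modeSet (n : ℕ) : (modeSet n).card = 2 :=
  Finset.card_pair (modeFreq_ne_neg n)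

/-- The coefficient family `k ↦ a/2` is conjugate symmetric (it is real and constant). [folklore] -/
theorem isConjSymmScalar_const (a : ℝ) : IsConjSymmScalar (fun _ : (Fin 2 → ℤ) => ((a / 2 : ℝ) : ℂ)) :=
  fun _ => (Complex.conj_ofReal _).symm

/-- The planar profile `y ↦ a cos(2π(n+1)y₀)`, as the real trigonometric polynomial with
coefficient `a/2` on the pair `±(n+1)e₀`. [folklore] -/
def profile (n : ℕ) (a : ℝ) : (UnitAddTorus (Fin 2)) → ℝ :=
  reTrigPoly (modeSet n) (fun _ => ((a / 2 : ℝ) : ℂ))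

/-- The profile is smooth. [folklore] -/
theorem isSmooth_profile (n : ℕ) (a : ℝ) : IsSmooth (profile n a) :=
  isSmooth_reTrigPoly _ _

/-- The profile is continuous. [folklore] -/
theorem continuous_profile (n : ℕ) (a : ℝ) : Continuous (profile n a) :=
  continuous_reTrigPoly _ _

/-- The profile as an explicit sum of cosines: `(a/2) ∑_{k=±(n+1)e₀} Re e_k`. [folklore] -/
theorem profile_apply (n : ℕ) (a : ℝ) (y : (UnitAddTorus (Fin 2))) :
    profile n a y = (a / 2) * ∑ k ∈ modeSet n, (mFourier k y).re := by
  rw [profile, reTrigPoly_eq_sum, Finset.mul_sum]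
  refine Finset.sum_congr rfl fun k _ => ?_
  rw [Complex.mul_re, Complex.ofReal_re, Complex.ofReal_im, mul_zero, sub_zero, mul_comm]

/-- Linearity in the amplitude. [folklore] -/
theorem profile_mul (n : ℕ) (c a : ℝ) (y : (UnitAddTorus (Fin 2))) : profile n (c * a) y = c * profile n a y := by
  rw [profile_apply, profile_apply]
  ring

/-- Pointwise bound `|a cos(2π(n+1)y₀)| ≤ |a|`. [folklore] -/
theorem abs_profile_le (n : ℕ) (a : ℝ) (y : (UnitAddTorus (Fin 2))) : |profile n a y| ≤ |a| := by
  rw [profile_apply, abs_mul]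
  have h : |∑ k ∈ modeSet n, (mFourier k y).re| ≤ 2 := by
    calc |∑ k ∈ modeSet n, (mFourier k y).re| ≤ ∑ k ∈ modeSet n, |(mFourier k y).re| :=
          Finset.abs_sum_le_sum_abs _ _
      _ ≤ ∑ k ∈ modeSet n, (1 : ℝ) := Finset.sum_le_sum fun k _ =>
          (Complex.abs_re_le_norm _).trans (((mFourier k).norm_coe_le_norm y).trans_eq mFourier_norm)
      _ = 2 := by simp [card_modeSet]
  calc |a / 2| * |∑ k ∈ modeSet n, (mFourier k y).re| ≤ |a / 2| * 2 :=
        mul_le_mul_of_nonneg_left h (abs_nonneg _)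
    _ = |a| := by rw [abs_div, abs_two]; ring

/-- `Δ (a cos(2π(n+1)y₀)) = -4π²(n+1)² a cos(2π(n+1)y₀)`. [folklore] -/
theorem laplacian_profile (n : ℕ) (a : ℝ) (y : (UnitAddTorus (Fin 2))) :
    Torus.laplacian (profile n a) y = -(4 * Real.pi ^ 2 * ((n : ℝ) + 1) ^ 2) * profile n a y := by
  have h : Torus.laplacian (profile n a) y =
      profile n (-(4 * Real.pi ^ 2 * ((n : ℝ) + 1) ^ 2) * a) y := by
    unfold profile
    rw [laplacian_reTrigPoly, reTrigPoly_eq_sum, reTrigPoly_eq_sum]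
    refine Finset.sum_congr rfl fun k hk => ?_
    rw [freqNormSq_of_mem_modeSet hk, smul_eq_mul, ← Complex.ofReal_mul]
    congr 2
    push_cast
    ring
  rw [h, profile_mul]

/-- `∫ (a cos(2π(n+1)y₀))² = a²/2`. [folklore] -/
theorem integral_profile_sq (n : ℕ) (a : ℝ) : ∫ y, profile n a y ^ 2 = a ^ 2 / 2 := by
  rw [profile, integral_sq_reTrigPoly (neg_mem_modeSet n) (isConjSymmScalar_const a),
    Finset.sum_const, card_modeSet, Complex.norm_real, Real.norm_eq_abs, sq_abs]
  ring

/-- `∫ ‖∇(a cos(2π(n+1)y₀))‖² = 2π²(n+1)²a²`. [folklore] -/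
theorem integral_norm_sq_gradient_profile (n : ℕ) (a : ℝ) :
    ∫ y, ‖Torus.gradient (profile n a) y‖ ^ 2 = 2 * Real.pi ^ 2 * ((n : ℝ) + 1) ^ 2 * a ^ 2 := by
  rw [profile, integral_norm_sq_gradient_reTrigPoly (neg_mem_modeSet n) (isConjSymmScalar_const a),
    Finset.sum_congr rfl fun k hk => by rw [freqNormSq_of_mem_modeSet hk], Finset.sum_const,
    card_modeSet, Complex.norm_real, Real.norm_eq_abs, sq_abs]
  ring

/-- The profile has zero mean (no zero mode). [folklore] -/
theorem hasZeroMean_profile (n : ℕ) (a : ℝ) : HasZeroMean (profile n a) := by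
  unfold HasZeroMean
  have h : ∀ k ∈ modeSet n, ∫ y : (UnitAddTorus (Fin 2)), (mFourier k y).re = 0 := by
    intro k hk
    have hint : Integrable (⇑(mFourier k) : (UnitAddTorus (Fin 2)) → ℂ) volume := (isSmooth_mFourier k).integrable
    have h1 := Complex.reCLM.integral_comp_comm hint
    simp only [Complex.reCLM_apply] at h1
    rw [h1, Torus.integral_mFourier, if_neg (ne_zero_of_mem_modeSet hk), Complex.zero_re]
  simp_rw [profile_apply]
  have hi : ∀ k ∈ modeSet n, Integrable (fun y : (UnitAddTorus (Fin 2)) => (mFourier k y).re) volume := fun k _ =>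
    (Complex.continuous_re.comp (mFourier k).continuous).integrable_unitAddTorus
  rw [integral_const_mul, integral_finsetSum (modeSet n) hi, Finset.sum_eq_zero h, mul_zero]

end Profile

/-! ## 2. The vertical shear field `(0, 0, a cos(2π(n+1)x₀))` on `T³` -/

section Shear

/-- The laminar vertical shear state `x ↦ (0, 0, a cos(2π(n+1)x₀))`: the planar lift of the pair
`(0, profile n a)`. [folklore] -/
def shear (n : ℕ) (a : ℝ) : (UnitAddTorus (Fin 3)) → (EuclideanSpace ℝ (Fin 3)) := twoHalf 0 (profile n a)

/-- Shear states are invariant under vertical translations (`x ↦ x + s e₃`). [folklore] -/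
theorem shear_add_single (n : ℕ) (a : ℝ) (s : UnitAddCircle) (x : (UnitAddTorus (Fin 3))) :
    shear n a (x + Pi.single (2 : Fin 3) s) = shear n a x := by
  rw [shear, twoHalf_eq_comp, Function.comp_apply, Function.comp_apply]
  exact comp_planarProj_add_single (fun y => planarEmbed ((0 : (UnitAddTorus (Fin 2)) → (EuclideanSpace ℝ (Fin 2))) y, profile n a y)) s x

/-- The zero planar field is smooth. [folklore] -/
theorem isSmooth_zero₂ : IsSmooth (0 : (UnitAddTorus (Fin 2)) → (EuclideanSpace ℝ (Fin 2))) := isSmooth_const (0 : (EuclideanSpace ℝ (Fin 2)))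

/-- The zero planar field has zero mean. [folklore] -/
theorem hasZeroMean_zero₂ : HasZeroMean (0 : (UnitAddTorus (Fin 2)) → (EuclideanSpace ℝ (Fin 2))) := by
  simp [HasZeroMean]

/-- The zero planar field has vanishing gradient norm. [folklore] -/
theorem gradNormSq_zero₂ : gradNormSq (0 : (UnitAddTorus (Fin 2)) → (EuclideanSpace ℝ (Fin 2))) = 0 := by
  simp [gradNormSq, Torus.partialDeriv, Torus.lineDeriv]

/-- Shear states are smooth. [folklore] -/
theorem isSmooth_shear (n : ℕ) (a : ℝ) : IsSmooth (shear n a) :=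
  isSmooth_zero₂.twoHalf (isSmooth_profile n a)

/-- Shear states are divergence free (the planar part vanishes). [folklore] -/
theorem isDivFree_shear (n : ℕ) (a : ℝ) : IsDivFree (shear n a) :=
  IsDivFree.twoHalf (fun x => by simp [Torus.divergence, Torus.partialDeriv, Torus.lineDeriv]) _

/-- Shear states have zero mean. [folklore] -/
theorem hasZeroMean_shear (n : ℕ) (a : ℝ) : HasZeroMean (shear n a) :=
  hasZeroMean_twoHalf (integrable_zero _ _ _) (continuous_profile n a).integrable_unitAddTorus
    hasZeroMean_zero₂ (hasZeroMean_profile n a)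

/-- `∫ ‖(0,0,a cos)‖² = a²/2`. [folklore] -/
theorem integral_norm_sq_shear (n : ℕ) (a : ℝ) : ∫ x, ‖shear n a x‖ ^ 2 = a ^ 2 / 2 := by
  rw [shear, integral_norm_sq_twoHalf continuous_zero (continuous_profile n a), integral_profile_sq]
  simp

/-- `‖∇(0,0,a cos(2π(n+1)x₀))‖²_{L²} = 2π²(n+1)²a²` (spectral form, the one inside `meanDissipation`). [folklore] -/
theorem toReal_eGradNormSq_shear (n : ℕ) (a : ℝ) :
    (eGradNormSq (shear n a)).toReal = 2 * Real.pi ^ 2 * ((n : ℝ) + 1) ^ 2 * a ^ 2 := by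
  rw [shear, toReal_eGradNormSq_twoHalf isSmooth_zero₂ (isSmooth_profile n a), gradNormSq_zero₂, zero_add,
    scalarGradNormSq, integral_norm_sq_gradient_profile]

/-- Pointwise bound `‖(0,0,a cos)‖ ≤ |a|`. [folklore] -/
theorem norm_shear_le (n : ℕ) (a : ℝ) (x : (UnitAddTorus (Fin 3))) : ‖shear n a x‖ ≤ |a| := by
  have h := norm_sq_twoHalf (0 : (UnitAddTorus (Fin 2)) → (EuclideanSpace ℝ (Fin 2))) (profile n a) x
  simp only [Pi.zero_apply, norm_zero, ne_eq, OfNat.ofNat_ne_zero, not_false_eq_true, zero_pow,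
    zero_add] at h
  have h2 : ‖shear n a x‖ ^ 2 ≤ |a| ^ 2 := by
    rw [shear, h, ← sq_abs (profile n a _)]
    exact pow_le_pow_left₀ (abs_nonneg _) (abs_profile_le n a _) 2
  exact (pow_le_pow_iff_left₀ (norm_nonneg _) (abs_nonneg _) two_ne_zero).1 h2

end Shear

/-! ## 3. The shear states solve Navier–Stokes classically, hence are global Leray–Hopf solutions -/

section Solution

/-- Time-independent fields have vanishing one-sided time derivative. [folklore] -/
theorem timeDerivWithin_const_fun {F : Type*} [NormedAddCommGroup F] [NormedSpace ℝ F]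
    (S : Set ℝ) (g : (UnitAddTorus (Fin 2)) → F) (t : ℝ) (y : (UnitAddTorus (Fin 2))) :
    Literature.Analysis.FunctionSpaces.Torus.timeDerivWithin S (fun _ : ℝ => g) t y = 0 := by
  simp [Literature.Analysis.FunctionSpaces.Torus.timeDerivWithin]

/-- `(0·∇)0 = 0`. [folklore] -/
theorem convect_zero₂ (y : (UnitAddTorus (Fin 2))) : Torus.convect (0 : (UnitAddTorus (Fin 2)) → (EuclideanSpace ℝ (Fin 2))) (0 : (UnitAddTorus (Fin 2)) → (EuclideanSpace ℝ (Fin 2))) y = 0 := by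
  simp [Torus.convect]

/-- `Δ0 = 0` (planar vector field). [folklore] -/
theorem laplacian_zero₂ (y : (UnitAddTorus (Fin 2))) : Torus.laplacian (0 : (UnitAddTorus (Fin 2)) → (EuclideanSpace ℝ (Fin 2))) y = 0 := by
  have h : liftAt (0 : (UnitAddTorus (Fin 2)) → (EuclideanSpace ℝ (Fin 2))) y = fun _ => 0 := rfl
  simp only [Torus.laplacian, h]
  rw [InnerProductSpace.laplacian_const]
  rfl

/-- `∇0 = 0` (planar scalar). [folklore] -/
theorem gradient_zero₂ (y : (UnitAddTorus (Fin 2))) : Torus.gradient (fun _ : (UnitAddTorus (Fin 2)) => (0 : ℝ)) y = 0 :=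
  gradient_fun_const (0 : (EuclideanSpace ℝ (Fin 2))) (0 : ℝ)

/-- **The residual force of the steady shear ansatz is the steady shear force**: with planar data
`V = 0`, `R = a cos(2π(n+1)y₀)`, `φ = 0`, `twoHalfForce univ ν V R φ = (0,0,-νΔR) = shear n (4π²(n+1)²νa)`. [folklore] -/
theorem twoHalfForce_shear (n : ℕ) (ν a : ℝ) :
    twoHalfForce univ ν (fun _ => (0 : (UnitAddTorus (Fin 2)) → (EuclideanSpace ℝ (Fin 2)))) (fun _ => profile n a) (fun _ _ => (0 : ℝ)) =
      fun _ => shear n (4 * Real.pi ^ 2 * ((n : ℝ) + 1) ^ 2 * ν * a) := by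
  funext t x
  rw [twoHalfForce_apply, shear]
  have h1 : (fun y => Literature.Analysis.FunctionSpaces.Torus.timeDerivWithin univ (fun _ : ℝ => (0 : (UnitAddTorus (Fin 2)) → (EuclideanSpace ℝ (Fin 2)))) t y +
      Torus.convect ((fun _ : ℝ => (0 : (UnitAddTorus (Fin 2)) → (EuclideanSpace ℝ (Fin 2)))) t) ((fun _ : ℝ => (0 : (UnitAddTorus (Fin 2)) → (EuclideanSpace ℝ (Fin 2)))) t) y -
      ν • Torus.laplacian ((fun _ : ℝ => (0 : (UnitAddTorus (Fin 2)) → (EuclideanSpace ℝ (Fin 2)))) t) y +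
      Torus.gradient ((fun _ _ => (0 : ℝ)) t) y) = (0 : (UnitAddTorus (Fin 2)) → (EuclideanSpace ℝ (Fin 2))) := by
    funext y
    simp only [timeDerivWithin_const_fun, convect_zero₂, laplacian_zero₂, gradient_zero₂, smul_zero]
    simp
  have h2 : (fun y => Literature.Analysis.FunctionSpaces.Torus.timeDerivWithin univ (fun _ : ℝ => profile n a) t y +
      ⟪((fun _ : ℝ => (0 : (UnitAddTorus (Fin 2)) → (EuclideanSpace ℝ (Fin 2)))) t) y, Torus.gradient ((fun _ : ℝ => profile n a) t) y⟫_ℝ -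
      ν * Torus.laplacian ((fun _ : ℝ => profile n a) t) y) =
      profile n (4 * Real.pi ^ 2 * ((n : ℝ) + 1) ^ 2 * ν * a) := by
    funext y
    simp only [timeDerivWithin_const_fun, Pi.zero_apply, inner_zero_left, laplacian_profile, profile_mul]
    ring
  rw [h1, h2]

/-- **The steady shear is a classical Navier–Stokes solution** on all of `ℝ × T³` with viscosity `ν`,
zero pressure and the steady force `shear n (4π²(n+1)²νa)` (the `2½`-dimensional packaging theorem
`Torus.isClassicalNSSolutionOn_twoHalf` with `V = 0`). [folklore] -/
theorem isClassicalNSSolutionOn_shear (n : ℕ) (ν a : ℝ) :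
    IsClassicalNSSolutionOn univ ν (fun _ => shear n (4 * Real.pi ^ 2 * ((n : ℝ) + 1) ^ 2 * ν * a))
      (fun _ => shear n a) (fun _ => (fun _ : (UnitAddTorus (Fin 2)) => (0 : ℝ)) ∘ planarProj) := by
  have hV : IsSmoothSpaceTimeOn univ (fun _ : ℝ => (0 : (UnitAddTorus (Fin 2)) → (EuclideanSpace ℝ (Fin 2)))) := isSmoothSpaceTimeOn_const isSmooth_zero₂ _
  have hR : IsSmoothSpaceTimeOn univ (fun _ : ℝ => profile n a) :=
    isSmoothSpaceTimeOn_const (isSmooth_profile n a) _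
  have hφ : IsSmoothSpaceTimeOn univ (fun _ : ℝ => fun _ : (UnitAddTorus (Fin 2)) => (0 : ℝ)) :=
    isSmoothSpaceTimeOn_const (isSmooth_const (0 : ℝ)) _
  have hcl := isClassicalNSSolutionOn_twoHalf uniqueDiffOn_univ ν hV hR hφ
    (fun _ _ x => by simp [Torus.divergence, Torus.partialDeriv, Torus.lineDeriv])
  rw [twoHalfForce_shear] at hcl
  exact hcl

/-- **The steady shear is a global Leray–Hopf solution** for the steady shear force (classical ⇒
Leray–Hopf on the torus, `Torus.IsClassicalNSSolutionOn.isGlobalLerayHopf`, proved in tree). The amplitude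
relation is taken as a hypothesis `hb` so that users can normalise the force. [folklore] -/
theorem isGlobalLerayHopf_shear (n : ℕ) {ν a b : ℝ} (hb : b = 4 * Real.pi ^ 2 * ((n : ℝ) + 1) ^ 2 * ν * a) :
    IsGlobalLerayHopf ν (fun _ => shear n b) (shear n a) (fun _ => shear n a) := by
  subst hb
  exact (isClassicalNSSolutionOn_shear n ν a).isGlobalLerayHopf

/-- Cesàro means of a constant. [folklore] -/
theorem timeMean_const_fun {c T : ℝ} (hT : T ≠ 0) : timeMean (fun _ : ℝ => c) T = c := by
  simp [timeMean, intervalIntegral.integral_const, hT]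

/-- Long-time averages of a constant. [folklore] -/
theorem longTimeAvgSup_const_fun (c : ℝ) : longTimeAvgSup (fun _ : ℝ => c) = c := by
  have h : timeMean (fun _ : ℝ => c) =ᶠ[atTop] fun _ => c :=
    (eventually_ne_atTop 0).mono fun T hT => timeMean_const_fun hT
  rw [longTimeAvgSup, limsup_congr h, limsup_const]

/-- **Mean energy of the steady shear**: `⟨‖u‖²⟩ = a²/2` (honest: constant Cesàro means). [folklore] -/
theorem meanEnergy_shear (n : ℕ) (a : ℝ) : meanEnergy (fun _ : ℝ => shear n a) = a ^ 2 / 2 := by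
  rw [meanEnergy_eq_longTimeAvgSup]
  simp_rw [integral_norm_sq_shear]
  exact longTimeAvgSup_const_fun _

/-- **Mean dissipation of the steady shear**: `⟨ν‖∇u‖²⟩ = 2π²(n+1)²νa²` (honest). [folklore] -/
theorem meanDissipation_shear (n : ℕ) (ν a : ℝ) :
    meanDissipation ν (fun _ : ℝ => shear n a) = ν * (2 * Real.pi ^ 2 * ((n : ℝ) + 1) ^ 2 * a ^ 2) := by
  unfold meanDissipation
  simp_rw [toReal_eGradNormSq_shear]
  exact longTimeAvgSup_const_fun _

/-- A real sequence bounded below by a positive constant does not tend to zero. [folklore] -/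
theorem not_tendsto_zero_of_le {d : ℕ → ℝ} {c : ℝ} (hc : 0 < c) (h : ∀ j, c ≤ d j) :
    ¬ Tendsto d atTop (𝓝 0) := fun ht => by
  obtain ⟨j, hj⟩ := (ht.eventually (gt_mem_nhds hc)).exists
  exact (not_lt.2 (h j)) hj

end Solution

end Summit.AnomalousDissipation.AnomalousDissipation.Theorems.TwohalfdNeg.Negative

end
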